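import Summits.ValiantsHypothesis.ValiantsHypothesis.Theorems.KPlusLogSqLawTropicalBToeplitzTwoPhase
import Summits.ValiantsHypothesis.ValiantsHypothesis.Theorems.KPlusLogSqLawTropicalBToeplitz

/-!
# Route `KPlusLogSqLaw`, crux `TropicalB` — Toeplitz sector: block-swap rigidity of unique optima and dominant terms

HONEST FRAMING.  Helper toward the registered stubs `stub_tropThin` / `stub_tropFat` of
`Cruxes/TropicalB/Lines/birth.lean` (crux `Summit.ValiantsHypothesis.ValiantsHypothesis.Theses.KPlusLogSqLaw.TropicalB`,
ledger item `stmt-ValiantsHypothesis-19771`, route `KPlusLogSqLaw`; cell `pub-symmetroid`, seat `val-sym-trop-p3`,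
2026-08-26).  A structural constraint on EVERY candidate of the cell's Conjecture T (linear Toeplitz instances, the
hypothesis of `toeplitz_chain_le_of_linearBound`) and on every dominant term of a Toeplitz design; it settles nothing about
`Φ`, `TropicalB`, `KPlusLogSqLaw`, `MatrixDescartes` or `VP ≠ VNP`.

THE SWAP.  If a permutation `σ` of `Fin m` leaves two ADJACENT intervals `I = [a, c)` and `J = [c, e)` invariant, the
conjugate `σ' = π⁻¹ σ π` by the block-swap bijection `π` (`exists_blockSwap_perm`: `x ↦ x + ℓ₁` on `[a, a + ℓ₂)`,
`x ↦ x − ℓ₂` on `[a + ℓ₂, e)`, identity elsewhere; `ℓ₁ = c − a`, `ℓ₂ = e − c`) carries the pattern of `J` first and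
that of `I` second, and its displacement sequence is that of `σ` re-indexed by `π` (`exists_blockSwap_conj`; the
complement of `[a, e)` is invariant too, `perm_not_mem_of_mapsTo`).  In the Toeplitz world (costs depend on the
displacement only) the swapped object has the SAME weight at every slope and the same presence.

THE RESULTS.
* `toeplitz_opt_blockSwap_invariant` — a permutation that is the UNIQUE maximiser of a linear Toeplitz instance among
  admissible permutations and has adjacent invariant blocks `I`, `J` equals its own block swap: its displacement sequence
  on `[a, e)` is invariant under the cyclic rotation by `ℓ₁` (`disp(x + ℓ₁) = disp x` on `[a, a + ℓ₂)`,
  `disp(x − ℓ₂) = disp x` on `[a + ℓ₂, e)`).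
* `toeplitz_dominant_blockSwap_invariant` — the same for a DOMINANT term `(σ, μ)` of a Toeplitz design
  (`v = f(a − b, l)`, `ε = g(a − b, l)`), with the class sequence `μ` rotation-invariant as well (transport lemma
  `toeplitz_dominant_eq_of_transport` of `…TropicalBToeplitz`).
READING.  Adjacent invariant blocks of equal length carry identical patterns; by iteration (Fine–Wilf) a unique optimum /
dominant permutation whose decomposition into minimal invariant intervals has several blocks is a POWER of one block — so
the optima of the ROUNDING regime of Conjecture T (`…TropicalBToeplitzUnitRegime`) are never «blocks plus a local
defect»: those tie with their swaps.  Together with `toeplitz_dominant_perm_unique_profile` this is the rigidity toolkit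
for the Toeplitz sector.

References: folklore (conjugation by a displacement-transporting bijection); `toeplitz_dominant_eq_of_transport`
(`…TropicalBToeplitz`, p427725).
-/

set_option linter.dupNamespace false
set_option autoImplicit false

namespace Summit.ValiantsHypothesis.ValiantsHypothesis.Theorems.KPlusLogSqLaw

open Summit.ValiantsHypothesis.ValiantsHypothesis.Theorems.MatrixDescartes.Negative
open scoped BigOperators
open Finset

section BlockSwap

variable {m K : ℕ}

/-- A permutation mapping a finite set into itself maps its complement into the complement. [folklore] -/
theorem perm_not_mem_of_mapsTo (τ : Equiv.Perm (Fin m)) (S : Finset (Fin m)) (hS : ∀ b ∈ S, τ b ∈ S)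
    (b : Fin m) (hb : b ∉ S) : τ b ∉ S := by
  intro h
  have himg : S.image τ = S := by
    apply eq_of_subset_of_card_le
    · intro y hy
      obtain ⟨x, hx, rfl⟩ := mem_image.mp hy
      exact hS x hx
    · rw [card_image_of_injective S τ.injective]
  rw [← himg] at h
  obtain ⟨x, hx, hxe⟩ := mem_image.mp h
  exact hb (τ.injective hxe ▸ hx)

/-- **The block-swap bijection of positions.**  For `a ≤ c ≤ e ≤ m` (blocks `I = [a, c)`, `J = [c, e)` of lengths
`ℓ₁ = c − a`, `ℓ₂ = e − c`) there is a permutation `π` of `Fin m` with `π x = x + ℓ₁` on `[a, a + ℓ₂)`, `π x = x − ℓ₂` on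
`[a + ℓ₂, e)`, and `π x = x` off `[a, e)`. [folklore] -/
theorem exists_blockSwap_perm (a c e : ℕ) (hac : a ≤ c) (hce : c ≤ e) (hem : e ≤ m) :
    ∃ π : Equiv.Perm (Fin m),
      (∀ x : Fin m, a ≤ (x : ℕ) → (x : ℕ) + (c - a) < e → ((π x : Fin m) : ℕ) = (x : ℕ) + (c - a)) ∧
      (∀ x : Fin m, e ≤ (x : ℕ) + (c - a) → (x : ℕ) < e → ((π x : Fin m) : ℕ) = (x : ℕ) - (e - c)) ∧
      (∀ x : Fin m, ((x : ℕ) < a ∨ e ≤ (x : ℕ)) → ((π x : Fin m) : ℕ) = (x : ℕ)) := by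
  let F : ℕ → ℕ := fun x => if x < a ∨ e ≤ x then x else if x + (c - a) < e then x + (c - a) else x - (e - c)
  let G : ℕ → ℕ := fun y => if y < a ∨ e ≤ y then y else if y < c then y + (e - c) else y - (c - a)
  have hF : ∀ x, x < m → F x < m := by intro x hx; simp only [F]; split_ifs <;> omega
  have hG : ∀ y, y < m → G y < m := by intro y hy; simp only [G]; split_ifs <;> omega
  have hGF : ∀ x, x < m → G (F x) = x := by
    intro x hx; simp only [F, G]; split_ifs <;> first | contradiction | omega
  have hFG : ∀ y, y < m → F (G y) = y := by
    intro y hy; simp only [F, G]; split_ifs <;> first | contradiction | omega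
  refine ⟨⟨fun x => ⟨F x, hF x x.isLt⟩, fun y => ⟨G y, hG y y.isLt⟩, fun x => Fin.ext (hGF x x.isLt),
    fun y => Fin.ext (hFG y y.isLt)⟩, fun x h1 h2 => ?_, fun x h1 h2 => ?_, fun x h => ?_⟩
  all_goals simp only [Equiv.coe_fn_mk, F]; split_ifs <;> omega

/-- **Conjugating by the block swap transports displacements.**  If `σ` leaves the adjacent intervals `I = [a, c)` and
`J = [c, e)` invariant, then for the block-swap bijection `π` of `exists_blockSwap_perm` the conjugate
`σ' = π⁻¹ ∘ σ ∘ π` (pattern of `J` first, then that of `I`, elsewhere `σ`) has displacement `σ' x − x = σ (π x) − π x`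
at every position: the displacement sequence of `σ'` is that of `σ` re-indexed by `π`. [folklore] -/
theorem exists_blockSwap_conj (σ : Equiv.Perm (Fin m)) (a c e : ℕ) (hac : a ≤ c) (hce : c ≤ e) (hem : e ≤ m)
    (hI : ∀ b : Fin m, a ≤ (b : ℕ) → (b : ℕ) < c → a ≤ ((σ b : Fin m) : ℕ) ∧ ((σ b : Fin m) : ℕ) < c)
    (hJ : ∀ b : Fin m, c ≤ (b : ℕ) → (b : ℕ) < e → c ≤ ((σ b : Fin m) : ℕ) ∧ ((σ b : Fin m) : ℕ) < e) :
    ∃ π : Equiv.Perm (Fin m),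
      (∀ x : Fin m, a ≤ (x : ℕ) → (x : ℕ) + (c - a) < e → ((π x : Fin m) : ℕ) = (x : ℕ) + (c - a)) ∧
      (∀ x : Fin m, e ≤ (x : ℕ) + (c - a) → (x : ℕ) < e → ((π x : Fin m) : ℕ) = (x : ℕ) - (e - c)) ∧
      (∀ x : Fin m, ((x : ℕ) < a ∨ e ≤ (x : ℕ)) → ((π x : Fin m) : ℕ) = (x : ℕ)) ∧
      (∀ x : Fin m, ((π.symm (σ (π x)) : Fin m) : ℤ) - x = ((σ (π x) : Fin m) : ℤ) - (π x : Fin m)) := by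
  obtain ⟨π, hπ1, hπ2, hπ3⟩ := exists_blockSwap_perm (m := m) a c e hac hce hem
  refine ⟨π, hπ1, hπ2, hπ3, fun x => ?_⟩
  -- `σ` maps the complement of `[a, e)` to itself
  have hC : ∀ b : Fin m, ((b : ℕ) < a ∨ e ≤ (b : ℕ)) → (((σ b : Fin m) : ℕ) < a ∨ e ≤ ((σ b : Fin m) : ℕ)) := by
    intro b hb
    have key := perm_not_mem_of_mapsTo σ (univ.filter fun x : Fin m => a ≤ (x : ℕ) ∧ (x : ℕ) < e) ?_ b ?_
    · simp only [mem_filter, mem_univ, true_and, not_and, not_lt] at key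
      by_cases h : a ≤ ((σ b : Fin m) : ℕ)
      · right; exact key h
      · left; omega
    · intro x hx
      simp only [mem_filter, mem_univ, true_and] at hx ⊢
      by_cases hxc : (x : ℕ) < c
      · have := hI x hx.1 hxc; constructor <;> omega
      · have := hJ x (by omega) hx.2; constructor <;> omega
    · simp only [mem_filter, mem_univ, true_and, not_and, not_lt]; intro h; omega
  by_cases hx : (x : ℕ) < a ∨ e ≤ (x : ℕ)
  · -- outside: everything fixed by `π`
    have hπx : π x = x := Fin.ext (hπ3 x hx)
    have h3 : π (σ x) = σ x := Fin.ext (hπ3 (σ x) (hC x hx))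
    have : π.symm (σ x) = σ x := by rw [Equiv.symm_apply_eq]; exact h3.symm
    rw [hπx, this]
  · push Not at hx
    by_cases hx2 : (x : ℕ) + (c - a) < e
    · -- `x ∈ [a, a + ℓ₂)`: `π x = x + ℓ₁ ∈ J`
      have h1 : ((π x : Fin m) : ℕ) = x + (c - a) := hπ1 x hx.1 hx2
      have hy := hJ (π x) (by omega) (by omega)
      let u : Fin m := ⟨((σ (π x) : Fin m) : ℕ) - (c - a), by omega⟩
      have hu : π u = σ (π x) := Fin.ext (by
        have := hπ1 u (by simp [u]; omega) (by simp [u]; omega)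
        simp [u] at this ⊢; omega)
      have : π.symm (σ (π x)) = u := by rw [Equiv.symm_apply_eq]; exact hu.symm
      rw [this]
      simp only [u]
      push_cast [show c - a ≤ ((σ (π x) : Fin m) : ℕ) by omega]
      push_cast [hac] at h1 ⊢
      omega
    · -- `x ∈ [a + ℓ₂, e)`: `π x = x − ℓ₂ ∈ I`
      push Not at hx2
      have h1 : ((π x : Fin m) : ℕ) = x - (e - c) := hπ2 x hx2 hx.2
      have hy := hI (π x) (by omega) (by omega)
      let u : Fin m := ⟨((σ (π x) : Fin m) : ℕ) + (e - c), by omega⟩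
      have hu : π u = σ (π x) := Fin.ext (by
        have := hπ2 u (by simp [u]; omega) (by simp [u]; omega)
        simp [u] at this ⊢; exact this)
      have : π.symm (σ (π x)) = u := by rw [Equiv.symm_apply_eq]; exact hu.symm
      rw [this]
      simp only [u]
      have hxe : e - c ≤ (x : ℕ) := by omega
      push_cast [hxe, hce] at h1 ⊢
      omega

/-- **Block-swap rigidity of unique optima (linear Toeplitz instances).**  Let `τ` be the unique maximiser, among
admissible permutations, of `W_θ(σ) = Σ_b (θ ψ(σ b − b) + α(σ b − b))`, and suppose `τ` leaves two ADJACENT intervals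
`I = [a, c)` and `J = [c, e)` invariant.  Swapping the two blocks (the pattern of `J` first, then that of `I`; elsewhere
unchanged) yields an admissible permutation with the same displacement multiset, hence the same weight — so it must BE `τ`:
the displacement sequence of `τ` on `[a, e)` is invariant under the cyclic rotation by `ℓ₁ = c − a`, i.e.
`disp(x + ℓ₁) = disp(x)` for `x ∈ [a, a + ℓ₂)` and `disp(x − ℓ₂) = disp(x)` for `x ∈ [a + ℓ₂, e)` (`ℓ₂ = e − c`).  In
particular two adjacent invariant blocks of EQUAL length carry the same displacement pattern, and (iterating, Fine–Wilf)
a unique optimum whose invariant-interval decomposition has several blocks is a power of ONE block: rounding optima are never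
«blocks plus a local defect». [folklore] -/
theorem toeplitz_opt_blockSwap_invariant (ψ α : ℤ → ℤ) (P : ℤ → Prop) (θ : ℤ) (τ : Equiv.Perm (Fin m))
    (a c e : ℕ) (hac : a ≤ c) (hce : c ≤ e) (hem : e ≤ m)
    (hI : ∀ b : Fin m, a ≤ (b : ℕ) → (b : ℕ) < c → a ≤ ((τ b : Fin m) : ℕ) ∧ ((τ b : Fin m) : ℕ) < c)
    (hJ : ∀ b : Fin m, c ≤ (b : ℕ) → (b : ℕ) < e → c ≤ ((τ b : Fin m) : ℕ) ∧ ((τ b : Fin m) : ℕ) < e)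
    (hτP : ∀ b, P ((τ b : ℤ) - b))
    (huniq : ∀ σ : Equiv.Perm (Fin m), σ ≠ τ → (∀ b, P ((σ b : ℤ) - b)) →
      ∑ b, (θ * ψ ((σ b : ℤ) - b) + α ((σ b : ℤ) - b)) < ∑ b, (θ * ψ ((τ b : ℤ) - b) + α ((τ b : ℤ) - b))) :
    (∀ x y : Fin m, a ≤ (x : ℕ) → (y : ℕ) = (x : ℕ) + (c - a) → (y : ℕ) < e →
        (τ y : ℤ) - y = (τ x : ℤ) - x) ∧
    (∀ x y : Fin m, e ≤ (x : ℕ) + (c - a) → (x : ℕ) < e → (y : ℕ) = (x : ℕ) - (e - c) →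
        (τ y : ℤ) - y = (τ x : ℤ) - x) := by
  obtain ⟨π, hπ1, hπ2, -, disp_conj⟩ := exists_blockSwap_conj τ a c e hac hce hem hI hJ
  set τ' : Equiv.Perm (Fin m) := (π.trans τ).trans π.symm with hτ'
  have ev : ∀ x, τ' x = π.symm (τ (π x)) := fun x => rfl
  -- same weight and admissibility, hence `τ' = τ`
  have hW : ∑ b, (θ * ψ ((τ' b : ℤ) - b) + α ((τ' b : ℤ) - b)) =
      ∑ b, (θ * ψ ((τ b : ℤ) - b) + α ((τ b : ℤ) - b)) := by
    rw [← Equiv.sum_comp π (fun b => θ * ψ ((τ b : ℤ) - b) + α ((τ b : ℤ) - b))]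
    exact sum_congr rfl fun x _ => by rw [ev, disp_conj]
  have hP' : ∀ b, P ((τ' b : ℤ) - b) := fun b => by rw [ev, disp_conj]; exact hτP _
  have heq : τ' = τ := by
    by_contra hne
    have := huniq τ' hne hP'
    rw [hW] at this
    exact lt_irrefl _ this
  have main : ∀ x : Fin m, ((τ x : Fin m) : ℤ) - x = ((τ (π x) : Fin m) : ℤ) - (π x : Fin m) := by
    intro x; rw [← disp_conj, ← ev, heq]
  constructor
  · intro x y hx hy hye
    have hπx : π x = y := Fin.ext (by rw [hπ1 x hx (by omega), hy])
    rw [main x, hπx]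
  · intro x y hx1 hx2 hy
    have hπx : π x = y := Fin.ext (by rw [hπ2 x hx1 hx2, hy])
    rw [main x, hπx]

/-- **Block-swap rigidity of dominant terms (Toeplitz designs).**  In a Toeplitz design (`v a b l = f (a − b) l`,
`ε a b l = g (a − b) l`) let `(σ, μ)` be a DOMINANT term whose permutation leaves the adjacent intervals `I = [a, c)`,
`J = [c, e)` invariant.  Then both the displacement sequence of `σ` and the class sequence `μ` on `[a, e)` are invariant
under the cyclic rotation by `ℓ₁ = c − a`: the block-swapped term (transport along the block-swap bijection,
`toeplitz_dominant_eq_of_transport`) has the same weight and is present, so it equals `(σ, μ)`.  Equal-length adjacent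
invariant blocks of a dominant permutation carry identical (displacement, class) patterns. [folklore] -/
theorem toeplitz_dominant_blockSwap_invariant (d : Fin K → ℕ) (f g : ℤ → Fin K → ℤ) (θ : ℤ)
    (σ : Equiv.Perm (Fin m)) (μ : Fin m → Fin K) (a c e : ℕ) (hac : a ≤ c) (hce : c ≤ e) (hem : e ≤ m)
    (hI : ∀ b : Fin m, a ≤ (b : ℕ) → (b : ℕ) < c → a ≤ ((σ b : Fin m) : ℕ) ∧ ((σ b : Fin m) : ℕ) < c)
    (hJ : ∀ b : Fin m, c ≤ (b : ℕ) → (b : ℕ) < e → c ≤ ((σ b : Fin m) : ℕ) ∧ ((σ b : Fin m) : ℕ) < e)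
    (hp : IsDominant d (fun a b l => f ((a : ℤ) - b) l) (fun a b l => g ((a : ℤ) - b) l) θ (σ, μ)) :
    (∀ x y : Fin m, a ≤ (x : ℕ) → (y : ℕ) = (x : ℕ) + (c - a) → (y : ℕ) < e →
        ((σ y : ℤ) - y = (σ x : ℤ) - x ∧ μ y = μ x)) ∧
    (∀ x y : Fin m, e ≤ (x : ℕ) + (c - a) → (x : ℕ) < e → (y : ℕ) = (x : ℕ) - (e - c) →
        ((σ y : ℤ) - y = (σ x : ℤ) - x ∧ μ y = μ x)) := by
  obtain ⟨π, hπ1, hπ2, -, disp_conj⟩ := exists_blockSwap_conj σ a c e hac hce hem hI hJ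
  set σ' : Equiv.Perm (Fin m) := (π.trans σ).trans π.symm with hσ'
  have ev : ∀ x, σ' x = π.symm (σ (π x)) := fun x => rfl
  -- transport along `β = π⁻¹`
  have hβ : ∀ b, (σ' (π.symm b) : ℤ) - (π.symm b : ℤ) = (σ b : ℤ) - (b : ℤ) := by
    intro b
    rw [ev, disp_conj, Equiv.apply_symm_apply]
  have hT := toeplitz_dominant_eq_of_transport d f g θ σ σ' π.symm μ hβ hp
  have h1 : σ' = σ := congrArg Prod.fst hT
  have h2 : ∀ j, μ (π j) = μ j := fun j => by
    have := congrArg Prod.snd hT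
    simpa using congrFun this j
  have main : ∀ x : Fin m, ((σ x : Fin m) : ℤ) - x = ((σ (π x) : Fin m) : ℤ) - (π x : Fin m) := by
    intro x; rw [← disp_conj, ← ev, h1]
  constructor
  · intro x y hx hy hye
    have hπx : π x = y := Fin.ext (by rw [hπ1 x hx (by omega), hy])
    exact ⟨by rw [main x, hπx], by rw [← h2 x, hπx]⟩
  · intro x y hx1 hx2 hy
    have hπx : π x = y := Fin.ext (by rw [hπ2 x hx1 hx2, hy])
    exact ⟨by rw [main x, hπx], by rw [← h2 x, hπx]⟩

end BlockSwap

end Summit.ValiantsHypothesis.ValiantsHypothesis.Theorems.KPlusLogSqLaw
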